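import Literature.NumberTheory.PAdicHodge.BmaxPlusTDivisibility
import Literature.NumberTheory.PAdicHodge.BmaxPlusTUnitTwo
import HarnessLib

/-!
# Fontaine's lemma `(A_max)^{φ=p} ∩ ker θ = ℤ_p · t/p` for every prime `p`

Topic `Literature/NumberTheory/PAdicHodge`; namespace `Literature.NumberTheory.PAdicHodge`. THEOREMS ONLY (no definition, no named
fact, no instance, no `sorry`). `BmaxPlusTDivisibility` proved Fontaine's lemma on Colmez's `A_max = B_max⁺(F)` for `p` odd, the only use of
`p ≠ 2` being the unit `v = t/([ε]−1)`; `BmaxPlusTUnitTwo` supplies that unit for every `p`. This file records the prime-free statements: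

* ★★★ `exists_sq_mul_eq_zpToAinf_mul_tBmax'` — **`φ(x) = p·x ∧ θ(x) = 0 ⇒ p²·x = ι(λ)·t`, `λ ∈ ℤ_p`, for every prime `p`**;
* `tDivisibility'`, `fontaineKernel'`, `frobBmaxPlus_eq_p_mul_and_theta_eq_zero_iff'` — (TDIV) and the characterisation of `ℚ_p·t ∩ A_max`,
  unconditional in `p`.

Brick B7 of the φ-road of line `kato_lever` (crux K★ `stmt-BirchSwinnertonDyer-22226`, memo
`Cruxes/StarredOptimalManinUnitFiveSeven/Lines/kato-lever-K2-tdiv-g25.md`). Infrastructure only: BSD / K★ are not proved by any of this.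

## References
* [FontaineAsterisque223III] J.-M. Fontaine, *Le corps des périodes p-adiques*, Astérisque 223 (1994), Exp. III Th. 5.3.7.
* [Colmez1998Annals] P. Colmez, *Théorie d'Iwasawa des représentations de de Rham d'un corps local*, Ann. of Math. 148 (1998), §III.3.
-/

noncomputable section

open WittVector Field ValuativeRel Polynomial Finset
open Literature.AlgebraicGeometry.Resolution

namespace Literature.NumberTheory.PAdicHodge

open Literature.NumberTheory.GaloisRepresentations
open Literature.NumberTheory.GaloisRepresentations.IsNonarchimedeanLocalField

variable {F : Type} [Field F] [ValuativeRel F] [TopologicalSpace F] [IsNonarchimedeanLocalField F]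
  [CharZero F] {p : ℕ} [Fact p.Prime] [Fact (¬ IsUnit (p : integerC F))]
  [IsAdicComplete (Ideal.span {(p : integerC F)}) (integerC F)]

set_option maxHeartbeats 1600000 in
/-- ★★★ **Fontaine's lemma on `A_max`, integral form, every prime `p`**: if `φ(x) = p·x` and `θ(x) = 0` then `p²·x = ι(λ)·t` for some
`λ ∈ ℤ_p`. [cite: FontaineAsterisque223III, Exp. III Th. 5.3.7] [cite: Colmez1998Annals, §III.3] -/
theorem exists_sq_mul_eq_zpToAinf_mul_tBmax' (hF : Function.Surjective (fontaineTheta (integerC F) p))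
    {x : BmaxPlus F p} (hx : frobBmaxPlus F p x = (p : BmaxPlus F p) * x) (hθ : thetaBmaxPlus F p x = 0) :
    ∃ lam : ℤ_[p], (p : BmaxPlus F p) ^ 2 * x = ainfToBmaxPlus F p (zpToAinf lam) * tBmax := by
  obtain ⟨z, hz⟩ := exists_eq_omegaB_mul_of_thetaBmaxPlus_eq_zero hF hθ
  obtain ⟨v, hvu, hvt⟩ := exists_isUnit_tBmax_eq_uAinf_mul' (F := F) (p := p)
  obtain ⟨w, hvw⟩ := hvu.exists_right_inv
  obtain ⟨c, hc, -⟩ := exists_omega_eq_xi_mul (F := F) (p := p)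
  have hy := frobBmaxPlus_eq_of_reduction hF hx hz hvt hvw hc
  obtain ⟨a, ha, hφa⟩ := exists_eq_ainfToBmaxPlus_of_frobBmaxPlus_eq hF hc hy
  obtain ⟨lam, hlam⟩ := exists_eq_zpToAinf_mul_uDivXi_of_frobenius_eq hc hφa
  refine ⟨lam, ?_⟩
  have ht : tBmax (F := F) (p := p) =
      (p : BmaxPlus F p) * algebraMap (bmaxZero F p) (BmaxPlus F p) omegaB * ainfToBmaxPlus F p uDivXi * v := by
    rw [hvt, ← xi_mul_uDivXi, map_mul, ainfToBmaxPlus_xi]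
  have hzy : z = z * w * v := by rw [mul_assoc, mul_comm w, hvw, mul_one]
  rw [hlam, map_mul] at ha
  calc (p : BmaxPlus F p) ^ 2 * x
      = (p : BmaxPlus F p) * algebraMap (bmaxZero F p) (BmaxPlus F p) omegaB * v * ((p : BmaxPlus F p) * (z * w)) := by
        rw [hz]; conv_lhs => rw [hzy]
        ring
    _ = ainfToBmaxPlus F p (zpToAinf lam) * tBmax := by rw [ha, ht]; ring

/-- ★★ **(TDIV) for every prime `p`**: `φx = px ∧ θx = 0 ⇒ ∃ k q, pᵏ·x = t·q`. [cite: Colmez1998Annals, §III.3] -/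
theorem tDivisibility' (hF : Function.Surjective (fontaineTheta (integerC F) p)) :
    ∀ x : BmaxPlus F p, frobBmaxPlus F p x = (p : BmaxPlus F p) * x → thetaBmaxPlus F p x = 0 →
      ∃ (k : ℕ) (q : BmaxPlus F p), (p : BmaxPlus F p) ^ k * x = tBmax * q := by
  intro x hx hθ
  obtain ⟨lam, h⟩ := exists_sq_mul_eq_zpToAinf_mul_tBmax' hF hx hθ
  exact ⟨2, ainfToBmaxPlus F p (zpToAinf lam), by rw [h, mul_comm]⟩

/-- ★★ **Fontaine's lemma through `fontaineKernel_of_tBmax_dvd`, every prime `p`.** [cite: FontaineAsterisque223III, Exp. III Th. 5.3.7] -/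
theorem fontaineKernel' (hF : Function.Surjective (fontaineTheta (integerC F) p))
    {x : BmaxPlus F p} (hx : frobBmaxPlus F p x = (p : BmaxPlus F p) * x) (hθ : thetaBmaxPlus F p x = 0) :
    ∃ (k : ℕ) (c : ℤ_[p]), (p : BmaxPlus F p) ^ k * x = ainfToBmaxPlus F p (zpToAinf c) * tBmax :=
  fontaineKernel_of_tBmax_dvd hF (tDivisibility' hF) hx hθ

/-- ★★ **`ℚ_p·t ∩ A_max` characterised, every prime `p`**: `φ(x) = p·x ∧ θ(x) = 0 ↔ ∃ k c, pᵏ·x = ι(c)·t`.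
[cite: FontaineAsterisque223III, Exp. III Th. 5.3.7] [cite: Colmez1998Annals, §III.3] -/
theorem frobBmaxPlus_eq_p_mul_and_theta_eq_zero_iff' (hF : Function.Surjective (fontaineTheta (integerC F) p)) (x : BmaxPlus F p) :
    (frobBmaxPlus F p x = (p : BmaxPlus F p) * x ∧ thetaBmaxPlus F p x = 0) ↔
      ∃ (k : ℕ) (c : ℤ_[p]), (p : BmaxPlus F p) ^ k * x = ainfToBmaxPlus F p (zpToAinf c) * tBmax :=
  frobBmaxPlus_eq_p_mul_and_theta_eq_zero_iff_of_tBmax_dvd hF (tDivisibility' hF) x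

end Literature.NumberTheory.PAdicHodge

end
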